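import Literature.AlgebraicGeometry.Frobenioids.MotivatingExamplesSubHoldsB
import HarnessLib

/-!
# Frobenioids I, Example 6.1 / Theorem 6.2 (ii)(iii): `C_{K̃/K}` IS a Frobenioid, of standard type, with the
# Frobenius functor isomorphic to the naive one — UNCONDITIONAL over `GeometricDivisorData` v4 — PROOF

Mochizuki, *The geometry of Frobenioids I: the general theory*, Kyushu J. Math. **62** (2008) 293–400,
Example 6.1, kurims text p. 109: "the assignments `L ↦ Φ(L)`, `L ↦ B(L)` determine, respectively, a perf-factorial
divisorial monoid `Φ` on `D` … Thus, by Theorem 5.2, (ii), this data determines a [model] Frobenioid"; Theorem 6.2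
(ii), (iii), pp. 110–112. [cite: MochizukiFrdI2008, Thm. 6.2 (iii) p.111]

PROOF-ONLY (seat abc-iut-L6-t10 gen 2, S3 sub-DAG holder). abc-iut-L1-t3's v4 of the interface
`GeometricDivisorData` (p413022) records the closure property `sub_mem` ("`Φ(L)^gp ⊆ ℤ[D_L]` may be identified with
the group of Cartier divisors on `V[L]`", p. 109; plan/GAP-LEDGER G-L6t10g2-1), so the conditional theorems of
`GeometricFrobenioidNonDilating.lean` / `MotivatingExamplesSubHoldsB.lean` become UNCONDITIONAL for every
`Γ : GeometricDivisorData K Kt` with `K̃/K` Galois: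
* `GeometricDivisorData.isDivisorial_phi` — `Φ(L)` is divisorial; `geom_hypotheses` — the hypotheses of Thm. 5.2;
* `geomFrobenioid_isFrobenioid` — **`C_{K̃/K}` IS A FROBENIOID** (abc-iut-found's Thm. 5.2 (ii));
* `isOfStandardType_geom` — **Thm. 6.2 (iii): `C_{K̃/K}` is of standard type** (abc-iut-L1-t2's Thm. 5.2 (iii));
* `nonempty_frobeniusPullbackFunctor_iso` — **Thm. 6.2 (ii)** with its Frobenioid premise discharged;
* `Thm62iii_iff_inputs` — t3's `Thm62iii` at the constructed model ⟺ the two input-gated conjuncts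
  (birationally Frobenius-normalized type of `Bi`, the rationally-standard clause over `R`);
* the sub-DAG rows by NAME: `Thm62_geomHypotheses_holds`, `Thm62_geomIsFrobenioid_holds`,
  `Thm62ii_unconditional_holds`, `Thm62iii_L06_standard_holds` (abc-iut-L1-t1's `MotivatingExamplesSub.lean`).
No definitions; nothing here bears on [IUTchIII] or asserts anything about abc.
-/

noncomputable section

namespace Literature.AlgebraicGeometry.Frobenioids

open CategoryTheory Opposite

variable {K : Type} [Field K] {Kt : Type} [Field Kt] [Algebra K Kt] (Γ : GeometricDivisorData K Kt)

/-- **Example 6.1: `Φ(L)` is a divisorial monoid** (FrdI p. 109) — for EVERY `Γ` (v4 `sub_mem`).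
[cite: MochizukiFrdI2008, Ex. 6.1 p.109] -/
theorem GeometricDivisorData.isDivisorial_phi (X : FinSubextCat K Kt) : IsDivisorial (Multiplicative (Γ.Phi X)) :=
  Γ.isDivisorial_phi_of_sub_mem X (Γ.sub_mem X)

variable [IsGalois K Kt]

/-- **Example 6.1 / Thm. 6.2: the hypotheses of Theorem 5.2 for `(Φ, B)` over `D = B(Gal(K̃/K))⁰`** — unconditional.
[cite: MochizukiFrdI2008, Ex. 6.1 p.109] -/
theorem geom_hypotheses : ModelFrobenioid.Hypotheses (geomDivisorFunctor Γ) (geomUnitsFunctor Γ) :=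
  geom_hypotheses_of Γ Γ.sub_mem

/-- **Example 6.1: "by Theorem 5.2, (ii), this data determines a [model] Frobenioid `C_{K̃/K}`"** (FrdI p. 109) —
`C_{K̃/K}` IS A FROBENIOID, unconditionally. [cite: MochizukiFrdI2008, Ex. 6.1 p.109] -/
theorem geomFrobenioid_isFrobenioid :
    PreFrobenioid.IsFrobenioid
      (ModelFrobenioid.toElem (geomDivisorFunctor Γ) (geomUnitsFunctor Γ) (geomDivNatTrans Γ)) :=
  geomFrobenioid_isFrobenioid_of Γ Γ.sub_mem

/-- **Theorem 6.2 (iii): `C_{K̃/K}` is of standard type** (FrdI p. 111; proof p. 112 l. 3–4) — unconditionally.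
[cite: MochizukiFrdI2008, Thm. 6.2 (iii) p.111] -/
theorem isOfStandardType_geom : (geomFrobenioidOps Γ).IsOfStandardType :=
  isOfStandardType_geom_of Γ Γ.sub_mem

/-- **Theorem 6.2 (ii)** (FrdI pp. 110–111): the Frobenius functor on `C_{K̃/K}` is isomorphic to the naive Frobenius
functor of degree `p` — the Frobenioid premise of `Thm62ii_holds` now DISCHARGED. [cite: MochizukiFrdI2008, Thm. 6.2 (ii) p.111] -/
theorem nonempty_frobeniusPullbackFunctor_iso (p : ℕ) [Fact p.Prime] [CharP K p] :
    Nonempty (frobeniusPullbackFunctor Γ ⟨p, (Fact.out : p.Prime).pos⟩ ≅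
      PreFrobenioid.naiveFrobeniusOf (geomFrobenioid_isFrobenioid Γ) ⟨p, (Fact.out : p.Prime).pos⟩) :=
  nonempty_frobeniusPullbackFunctor_iso_of Γ Γ.sub_mem p

/-- **Theorem 6.2 (iii)** for the constructed model, REDUCED unconditionally to its two input-gated conjuncts:
birationally Frobenius-normalized type of `Bi` and the rationally-standard clause over `R` (isotropic, standard and
not-group-like are PROVED). [cite: MochizukiFrdI2008, Thm. 6.2 (iii) p.111] -/
theorem Thm62iii_iff_inputs (Bi : (geomModelFrobenioid Γ).ops.BiratData) (R : (geomModelFrobenioid Γ).ops.RSParams) :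
    Thm62iii (geomModelFrobenioid Γ) Bi R ↔
      (PreFrobenioidData.IsOfBiratFrobeniusNormalizedType Bi ∧
        ((∀ (X : FinSubextCat K Kt) (P : Γ.primeDiv X), ∃ f : Γ.B X,
            (Multiplicative.toAdd (Γ.div X f)) P ≠ 0) → (geomFrobenioidOps Γ).IsOfRationallyStandardType R)) :=
  Thm62iii_iff_of_sub_mem Γ Γ.sub_mem Bi R

/-! ### The sub-DAG rows by name (abc-iut-L1-t1's `MotivatingExamplesSub.lean`) -/

/-- **T62ii/L03** — the hypotheses of Thm. 5.2 for the data of Ex. 6.1, now for EVERY `Γ`. [cite: MochizukiFrdI2008, Ex. 6.1 p.109] -/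
theorem Thm62_geomHypotheses_holds : Thm62_geomHypotheses Γ := geom_hypotheses Γ

/-- **T62ii/L04** — `C_{K̃/K}` is a Frobenioid, for EVERY `Γ`. [cite: MochizukiFrdI2008, Thm. 6.2 p.110] -/
theorem Thm62_geomIsFrobenioid_holds : Thm62_geomIsFrobenioid Γ := geomFrobenioid_isFrobenioid Γ

/-- **T62ii/L06** — Thm. 6.2 (ii) with its Frobenioid premise discharged, for EVERY `Γ`. [cite: MochizukiFrdI2008, Thm. 6.2 (ii) p.111] -/
theorem Thm62ii_unconditional_holds (p : ℕ) [Fact p.Prime] [CharP K p] : Thm62ii_unconditional Γ p :=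
  Thm62ii_unconditional_of_subMem Γ p Γ.sub_mem

/-- **T62iii/L06** — "hence that `C` is of standard type", for EVERY `Γ`. [cite: MochizukiFrdI2008, Thm. 6.2 (iii) p.112] -/
theorem Thm62iii_L06_standard_holds : Thm62iii_L06_standard Γ := isOfStandardType_geom Γ

end Literature.AlgebraicGeometry.Frobenioids

end
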